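import Summits.BirchSwinnertonDyer.Rank1Residual.Partition.CornersMultSchneider
import Summits.BirchSwinnertonDyer.Rank1Residual.X2.ClassClosureO9
import HarnessLib

/-!
# The MULTIPLICATIVE axis in rank `≤ 1` modulo the pair's Schneider certificate: the X2 corner
# SHRINKS by its rank-one non-split Greenberg–Vatsal-parity part (cell `b2b-bsdres`, RESIDUAL-MAP.md
# §C corner 'X2', §I O9 = X2c; CLASS-CLOSURE lane E2 kernel form for O9; seat `cc-typer-6`, an OFFER
# to the §C owner rmap-1 and to referee A — nothing is booked here)

HONEST FRAMING (run/shared/lean/b2b/bsd-rank1-residual/, verbatim in every file): the goal of the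
cell is to DELETE the COMBINATION-SHAPED residual classes of the Birch–Swinnerton-Dyer formula for
ALL analytic-rank `≤ 1` elliptic curves over `ℚ` — "full BSD formula for every rank `≤ 1` curve in
class `C`" assembled STRICTLY from published theorems — so that the rank-`≤ 1` remainder becomes
exactly the CONSTRUCTION-SHAPED classes, which are TYPED (missing-input `Prop`s), NOT attempted.
This is not "finishing BSD". Theorems only; NO definition, NO named fact introduced here; every
published theorem enters as one of the tree's existing named Literature facts BY NAME; nothing
about any particular curve is asserted; no label changes; X2c (O9) stays CONSTRUCTION-SHAPED until
referee A rules (reading flags: `GV00-mult-asserted` on `lambdaMu_multiplicative_of_gvPar`, Disegni's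
unit-`u` transcription A180, heights SW §4.2 = Schneider = Nekovář).

## What this file records

`Partition/CornersMultSchneider.lean` (rmap-1 gen 8) proves, for an odd multiplicative `p` and
`r_an ≤ 1`, granted the pair's Schneider certificate: `BSD(E,p)` unless X11a, or **X2** (reducible
`E[p]`, BOTH ranks, wholesale), or X11b off the lever's locus. Its rank-one engine is cc-typer-3's
pair-level lever `X11b.bsdp_of_nonsplit_of_relativeLeadingTerm_of_schneider` (Jones's SW Thm. 6.1 +
the relative leading term + `SchneiderConjecture Dh`), which needs the main-conjecture EQUALITY at
the pair in the shape `ι(g·w) = ϖ·L` — on X11b that is Skinner 2016 Thm. A. **On the reducible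
class X2 at a NON-SPLIT `p` of the Greenberg–Vatsal parity the same equality is PUBLISHED**: the
tree theorem `X2.mazurMainConjectureAt_of_gvPar` (X2/RankZero.lean: Greenberg–Vatsal 2000 at
`p ‖ N`, `λ = μ = 0` on the gvpar locus, `lambdaMu_multiplicative_of_gvPar` — flag
`GV00-mult-asserted` — with Wuthrich 2014 Thm. 16's divisibility for reducible `E[p]`,
`thm16_charIdeal_dvd_multiplicative_of_reducible`) delivers `X2.MazurMainConjectureAt W p`, whose
non-split clause IS `ι(g·w) = ϖ·L` for THE non-split MTT function. Disegni 2020 Thm. 1 = Thm. 4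
(first bullet: "not split multiplicative", NO condition on the image of `E[p]`; A180
`thm1_padicBSD_rankOne_multiplicative`, the SAME named fact rmap-1's file consumes) supplies the
relative leading term. Hence, with NO new fact and the SAME ten binders plus the two X2a facts
(`hGV`, `hWu`) already used by `Corners.lean`'s rank-`0` X2a theorems:

* `X2.bsdp_of_cellC_of_not_split_of_mazurMainConjectureAt_of_thm1_of_schneider` — X2c ∧ ¬split ∧
  Mazur's MC at the pair ∧ the certificate ⇒ `BSD(E,p)` (the O9 theorem of `X2/ClassClosureO9.lean`
  re-derived from A180 instead of the second transcription `padicBSD_rankOne_nonsplitMult` (p249273)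
  — the two transcriptions of Disegni's theorem thereby serve the same conclusion; no Gross–Zagier
  binder needed here since A180 carries `#Ш_an ∈ ℚ`);
* `X2.bsdp_of_cellC_of_not_split_of_gvPar_of_thm1_of_schneider` — the gvpar sub-cell
  `X2.CellCNonsplitGV` (O9/SUBPARTITION.md (i)) ⇒ `BSD(E,p)` modulo the certificate;
* `bsdp_mult_of_schneider_sharp_cellC` / `bsdp_or_corner_mult_of_schneider_cellC` — **odd
  multiplicative `p`, `r ≤ 1`, the certificate: `BSD(E,p)` unless X11a, or
  X2 MINUS (`r = 1` ∧ ¬split ∧ gvpar), or X11b off the lever's locus** — twelve named facts;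
* `bsdp_goodOrd_or_mult_of_five_le_rankLeOne_of_certificates_cellC` — the coordinator's widened
  domain at `p ≥ 5` ('good ordinary, or multiplicative', both ranks) with the X2 corner so shrunk —
  twenty-one named facts.

What does NOT shrink (typed, not attempted; `X2/ClassClosureO9.lean` §5, O9/STATEMENT.md): X2c at a
SPLIT `p` (no exceptional-zero leading term in print for reducible `E[p]` — Disegni's second bullet
rests on Venerucci 2016, printed under `A_p` irreducible; residue `X2.O9.ExceptionalLeadingTermAt`),
X2c non-split of the other parity (Mazur's MC at the pair only per pair, route G:
`X2/CongruenceTransferRankOne.lean`), and all of X2 in rank `0` off gvpar (X2b). Census pointer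
(EVIDENCE, HOME census/, never a Literature fact): O9 = 138 ψ-odd X2c window pairs at `p ∈ {3,5,7}`
plus the `p = 3` anomalous list; the gvpar/non-split share is cc-eng-1's GVPar column (asked
2026-08-21). The binders `hSchN` / `hSchS` are PER PAIR.

References: `Partition/CornersMultSchneider.lean` (rmap-1 g8); `X11b/ClassClosureDisegniLever.lean`
(cc-typer-3, p249340); `X2/RankZero.lean`; `X2/ClassClosureO9.lean` (p249649); RESIDUAL-MAP.md §C,
§I O9; CLASS-CLOSURE-PLAN.md §3.7; [Disegni2020] Thm. 1 (§1.2) = Thm. 4 (§3.2);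
[GreenbergVatsal2000] Thm. (1.3), pp. 14–15; [Wuthrich2014] Thm. 16; [SteinWuthrich2013] Thm. 6.1,
§4.2; [Skinner2016PacificMC] Thm. A, C; [Miller2011LMS] Def. 1.1.
-/

namespace Summit.BirchSwinnertonDyer.Rank1Residual

open WeierstrassCurve Literature.NumberTheory.EllipticCurves
  Literature.NumberTheory.EllipticCurves.Rank1Residual Literature.NumberTheory.EllipticCurves.ModularForms
  Literature.NumberTheory.EllipticCurves.Wuthrich2014
  Literature.NumberTheory.EllipticCurves.GreenbergVatsal2000
  Literature.NumberTheory.EllipticCurves.Rank1Residual.Typed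
  Literature.NumberTheory.EllipticCurves.Skinner2016
  Literature.NumberTheory.EllipticCurves.SteinWuthrich2013
  Literature.NumberTheory.EllipticCurves.Disegni2020
open scoped NumberField ModularForm

/-! ### X2c at a non-split prime: the lever with the MC equality from Greenberg–Vatsal -/

namespace X2

section Pair

variable (W : WeierstrassCurve ℚ) [W.IsElliptic] [W.IsGloballyMinimal] (p : ℕ) [Fact p.Prime]

/-- **X2c, NON-SPLIT `p`: Mazur's MC at the pair + the Schneider certificate ⟹ `BSD(E,p)`, the
relative leading term fed from A180 (`thm1_padicBSD_rankOne_multiplicative`, Disegni 2020 Thm. 1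
non-split clause — "not split multiplicative", any image of `E[p]`).** Data (cyclotomic tower, dual
Selmer datum, newform, `ϖ`, THE non-split MTT function, the Tate parameter, THE §4.2 height) are
instantiated from tree theorems exactly as in cc-typer-3's `X11b.bsdp_of_ram_nonsplit_of_schneider`,
with `hMC : MazurMainConjectureAt W p` in place of Skinner's Thm. A; then the pair-level lever
`X11b.bsdp_of_nonsplit_of_relativeLeadingTerm_of_schneider` (its name's `X11b` is only its namespace —
no irreducibility enters it). CONDITIONAL on the named facts, on `hMC` and on the per-pair `hSch`;
nothing booked. [cite: Disegni2020, Thm. 1 (§1.2) = Thm. 4 first bullet (§3.2)]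
[cite: SteinWuthrich2013, Thm. 6.1 (p. 20), §4.2] [cite: Miller2011LMS, Def. 1.1] -/
theorem bsdp_of_cellC_of_not_split_of_mazurMainConjectureAt_of_thm1_of_schneider
    (hD : thm1_padicBSD_rankOne_multiplicative) (hJn : thm61_nonsplitMultiplicative)
    (hHn : exists_isMultCanonical) (hGZK : rank_eq_analyticRank_of_analyticRank_le_one)
    (hpar : nonempty_modularParametrizationData)
    (hc : CellC W p) (hns : ¬ W.HasSplitMultiplicativeReductionAtPrime p)
    (hMC : MazurMainConjectureAt W p)
    (hSch : ∀ (q : ℚ_[p]) (Dh : PAdicHeightData W p), q ≠ 0 → ‖q‖ < 1 → tateJ q = (W.j : ℚ_[p]) →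
      IsMultCanonical Dh q → SchneiderConjecture Dh) :
    BSDp W p := by
  obtain ⟨hr1, hp2, -, hmult⟩ := hc
  obtain ⟨κ, hκ, γ, hγ, hγ'⟩ := exists_isCyclotomic_isTopGenerator_isCyclotomicVariable_holds p
  obtain ⟨D⟩ := W.nonempty_selmerDualData_holds κ γ hγ
  haveI : NeZero (W.conductorNorm ℤ) := ⟨(W.conductorNorm_pos_holds).ne'⟩
  obtain ⟨Dm⟩ := hpar W
  obtain ⟨ϖ, hϖpos, hϖ, -⟩ := Dm.exists_rat_mul_realPeriodRat_eq_plusPeriod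
  obtain ⟨L, hL⟩ := exists_isMultPAdicLFunctionOf_neg_one_of_nonsplit Dm.isNewformOf hmult hns
  obtain ⟨q, ⟨hq0, hq1, hqj⟩, -⟩ := existsUnique_tateJ_eq_of_one_lt_norm
    (one_lt_norm_j_of_hasMultiplicativeReductionAtPrime (W := W) (p := p) hmult)
  obtain ⟨Dh, hDh⟩ := hHn W p hp2 hmult hns q hq0 hq1 hqj
  -- (MC=) at the pair, non-split clause: `ι(g·w) = ϖ·L`
  obtain ⟨hXt, g, hchar, -, hnsp⟩ := hMC κ γ hκ hγ hγ' Dm.f Dm.isNewformOf D ϖ hϖ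
  obtain ⟨w, hw⟩ := hnsp hns L hL
  -- (D) Disegni Thm. 1, non-split clause, from the named fact A180
  obtain ⟨s, u', hs, hDis⟩ := thm1_padicBSD_rankOne_multiplicative.nonsplit hD W p hp2 hmult hr1
    Dm.isNewformOf ϖ hϖpos.ne' hϖ hns hq0 hq1 hqj L hL Dh hDh
  exact X11b.bsdp_of_nonsplit_of_relativeLeadingTerm_of_schneider W p hJn hGZK hp2 hr1 hmult hns hq0
    hq1 hqj hκ hγ hγ' D hXt hchar w hw Dh hDh hs u' hDis (hSch q Dh hq0 hq1 hqj hDh)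

/-- **Sub-cell `X2.CellCNonsplitGV` (X2c ∧ ¬split ∧ gvpar) ⟹ `BSD(E,p)` modulo the pair's Schneider
certificate, from PUBLISHED named facts only**: Mazur's MC at the pair is the tree theorem
`X2.mazurMainConjectureAt_of_gvPar` (Greenberg–Vatsal 2000 at `p ‖ N`, `hGV`, flag
`GV00-mult-asserted`; Wuthrich 2014 Thm. 16, `hWu`), the leading term is A180 (`hD`). The kernel
form of O9/SUBPARTITION.md (i). CONDITIONAL; nothing booked; X2c stays CONSTRUCTION-SHAPED.
[cite: GreenbergVatsal2000, Thm. (1.3) with pp. 1, 14–15] [cite: Wuthrich2014, Thm. 16 (p. 397)]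
[cite: Disegni2020, Thm. 1 (§1.2) = Thm. 4 first bullet (§3.2)] [cite: SteinWuthrich2013, Thm. 6.1, §4.2] -/
theorem bsdp_of_cellC_of_not_split_of_gvPar_of_thm1_of_schneider
    (hD : thm1_padicBSD_rankOne_multiplicative) (hGV : lambdaMu_multiplicative_of_gvPar)
    (hWu : thm16_charIdeal_dvd_multiplicative_of_reducible) (hJn : thm61_nonsplitMultiplicative)
    (hHn : exists_isMultCanonical) (hGZK : rank_eq_analyticRank_of_analyticRank_le_one)
    (hpar : nonempty_modularParametrizationData) (hc : CellCNonsplitGV W p)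
    (hSch : ∀ (q : ℚ_[p]) (Dh : PAdicHeightData W p), q ≠ 0 → ‖q‖ < 1 → tateJ q = (W.j : ℚ_[p]) →
      IsMultCanonical Dh q → SchneiderConjecture Dh) :
    BSDp W p :=
  bsdp_of_cellC_of_not_split_of_mazurMainConjectureAt_of_thm1_of_schneider W p hD hJn hHn hGZK hpar
    hc.1 hc.2.1 (mazurMainConjectureAt_of_gvPar hGV hWu W p hc.1.2.1 hc.1.2.2.2 hc.2.2) hSch

end Pair

end X2

/-! ### The §C headline in rank `≤ 1`, X2 corner shrunk modulo the certificate -/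

section Curve

variable {W : WeierstrassCurve ℚ} [W.IsElliptic] [W.IsGloballyMinimal] {p : ℕ} [Fact p.Prime]

/-- **SHARP MODULO THE SCHNEIDER CERTIFICATE, multiplicative axis, rank `≤ 1`, X2 corner shrunk:
TWELVE named facts.** For every `E/ℚ` (globally minimal `W`) of analytic rank `≤ 1` and every ODD
prime `p` of MULTIPLICATIVE reduction carrying the pair's Schneider certificate (`hSchN` / `hSchS`),
`BSD(E,p)` holds unless `(E, p)` lies in X11a, in X2 OFF the sub-cell (`r = 1` ∧ ¬split ∧ gvpar), or
in X11b off the lever's locus. rmap-1's `bsdp_mult_of_schneider_sharp` (ten facts) plus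
`X2.bsdp_of_cellC_of_not_split_of_gvPar_of_thm1_of_schneider` (`hGV`, `hWu`). [folklore] -/
theorem bsdp_mult_of_schneider_sharp_cellC (hSk : Skinner2016.thmC_padicValRat_bsd_rank_zero)
    (hmod : hasEntireLFunction_rat) (hGZK : rank_eq_analyticRank_of_analyticRank_le_one)
    (hA : thmA_charIdeal_multiplicative)
    (hJn : thm61_nonsplitMultiplicative) (hJs : thm61_splitMultiplicative)
    (hHn : exists_isMultCanonical) (hHs : exists_isSplitMultCanonical)
    (hD : thm1_padicBSD_rankOne_multiplicative) (hpar : nonempty_modularParametrizationData)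
    (hGV : lambdaMu_multiplicative_of_gvPar) (hWu : thm16_charIdeal_dvd_multiplicative_of_reducible)
    (hp : p ≠ 2) (hm : Mult W p) (hr : W.analyticRank ≤ 1)
    (hSchN : ∀ (q : ℚ_[p]) (Dh : PAdicHeightData W p), q ≠ 0 → ‖q‖ < 1 → tateJ q = (W.j : ℚ_[p]) →
      IsMultCanonical Dh q → SchneiderConjecture Dh)
    (hSchS : ∀ (Dq : TateParameterData W p) (Dh : PAdicHeightData W p),
      IsSplitMultCanonical Dh Dq → SchneiderConjecture Dh)
    (hX11a : ¬ ClassX11a W p)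
    (hX2 : ¬ (ClassX2 W p ∧
      ¬ (W.analyticRank = 1 ∧ ¬ W.HasSplitMultiplicativeReductionAtPrime p ∧ GVPar W p)))
    (hlev : ¬ (ClassX11b W p ∧ ¬ (Ram W p ∧ (W.HasSplitMultiplicativeReductionAtPrime p → 5 ≤ p)))) :
    BSDp W p := by
  by_cases hX2' : ClassX2 W p
  · have hsub : W.analyticRank = 1 ∧ ¬ W.HasSplitMultiplicativeReductionAtPrime p ∧ GVPar W p := by
      by_contra hnot
      exact hX2 ⟨hX2', hnot⟩
    exact X2.bsdp_of_cellC_of_not_split_of_gvPar_of_thm1_of_schneider W p hD hGV hWu hJn hHn hGZK hpar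
      ⟨⟨hsub.1, hX2'⟩, hsub.2.1, hsub.2.2⟩ hSchN
  · exact bsdp_mult_of_schneider_sharp hSk hmod hGZK hA hJn hJs hHn hHs hD hpar hp hm hr hSchN hSchS
      hX11a hX2' hlev

/-- **Partition form on the multiplicative axis, rank `≤ 1`, modulo the certificate, X2 shrunk:
`BSD(E,p) ∨ X11a ∨ (X2 ∧ ¬(r = 1 ∧ ¬split ∧ gvpar)) ∨ (X11b off the lever's locus)`** from the same
twelve named facts. [folklore] -/
theorem bsdp_or_corner_mult_of_schneider_cellC (hSk : Skinner2016.thmC_padicValRat_bsd_rank_zero)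
    (hmod : hasEntireLFunction_rat) (hGZK : rank_eq_analyticRank_of_analyticRank_le_one)
    (hA : thmA_charIdeal_multiplicative)
    (hJn : thm61_nonsplitMultiplicative) (hJs : thm61_splitMultiplicative)
    (hHn : exists_isMultCanonical) (hHs : exists_isSplitMultCanonical)
    (hD : thm1_padicBSD_rankOne_multiplicative) (hpar : nonempty_modularParametrizationData)
    (hGV : lambdaMu_multiplicative_of_gvPar) (hWu : thm16_charIdeal_dvd_multiplicative_of_reducible)
    (hp : p ≠ 2) (hm : Mult W p) (hr : W.analyticRank ≤ 1)
    (hSchN : ∀ (q : ℚ_[p]) (Dh : PAdicHeightData W p), q ≠ 0 → ‖q‖ < 1 → tateJ q = (W.j : ℚ_[p]) →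
      IsMultCanonical Dh q → SchneiderConjecture Dh)
    (hSchS : ∀ (Dq : TateParameterData W p) (Dh : PAdicHeightData W p),
      IsSplitMultCanonical Dh Dq → SchneiderConjecture Dh) :
    BSDp W p ∨ ClassX11a W p ∨
      (ClassX2 W p ∧ ¬ (W.analyticRank = 1 ∧ ¬ W.HasSplitMultiplicativeReductionAtPrime p ∧ GVPar W p)) ∨
      (ClassX11b W p ∧ ¬ (Ram W p ∧ (W.HasSplitMultiplicativeReductionAtPrime p → 5 ≤ p))) := by
  by_cases hX11a : ClassX11a W p
  · exact Or.inr (Or.inl hX11a)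
  · by_cases hX2 : ClassX2 W p ∧
        ¬ (W.analyticRank = 1 ∧ ¬ W.HasSplitMultiplicativeReductionAtPrime p ∧ GVPar W p)
    · exact Or.inr (Or.inr (Or.inl hX2))
    · by_cases hlev : ClassX11b W p ∧ ¬ (Ram W p ∧ (W.HasSplitMultiplicativeReductionAtPrime p → 5 ≤ p))
      · exact Or.inr (Or.inr (Or.inr hlev))
      · exact Or.inl (bsdp_mult_of_schneider_sharp_cellC hSk hmod hGZK hA hJn hJs hHn hHs hD hpar hGV
          hWu hp hm hr hSchN hSchS hX11a hX2 hlev)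

/-! ### The coordinator's domain at `p ≥ 5`, both ranks, X2 corner shrunk -/

/-- **Non-CM, `p ≥ 5`, 'good ORDINARY, or MULTIPLICATIVE', analytic rank `≤ 1`: TWENTY-ONE named
facts.** rmap-1's `bsdp_goodOrd_or_mult_of_five_le_rankLeOne_of_certificates` with the X2 corner
replaced by X2 off (`r = 1` ∧ ¬split ∧ gvpar): granted the certificates of its statement, `BSD(E,p)`
holds unless `(E, p)` lies in `X1 ∧ ¬gvpar`, in X11a, in X2 off that sub-cell, or in X11b without a
(ram) witness. [folklore] -/
theorem bsdp_goodOrd_or_mult_of_five_le_rankLeOne_of_certificates_cellC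
    (hBCS : BurungaleCastellaSkinner2025.cor131_padicValRat_bsd_rank_le_one)
    (hBCSa : burungale_castella_skinner_charIdeal_eq_padicLFunction)
    (hGZK : rank_eq_analyticRank_of_analyticRank_le_one)
    (hCGS : CastellaGrossiSkinner2025.thmD_padicValRat_bsd_rank_le_one)
    (hGVg : GreenbergVatsal2000.thm13_charIdeal_eq_of_gvPar) (hGr : greenberg_charValue_rankZero)
    (hmod : hasEntireLFunction_rat) (hmodP : nonempty_modularParametrizationData)
    (hS : Schneider1985_order_charGenerator) (hPR : perrinRiou_rankOne_leadingTerms)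
    (hΩ : realPeriodRat_eq_unit_mul_plusPeriod)
    (hSk : Skinner2016.thmC_padicValRat_bsd_rank_zero) (hA : thmA_charIdeal_multiplicative)
    (hJn : thm61_nonsplitMultiplicative) (hJs : thm61_splitMultiplicative)
    (hHn : exists_isMultCanonical) (hHs : exists_isSplitMultCanonical)
    (hD : thm1_padicBSD_rankOne_multiplicative)
    (hGV : lambdaMu_multiplicative_of_gvPar) (hWu : thm16_charIdeal_dvd_multiplicative_of_reducible)
    (hcm : ¬ W.HasCM) (hr : W.analyticRank ≤ 1) (h5 : 5 ≤ p) (hdom : GoodOrd W p ∨ Mult W p)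
    (hSch : ∀ Dh : PAdicHeightData W p, Dh.IsCanonical → SchneiderConjecture Dh)
    (hSchN : ∀ (q : ℚ_[p]) (Dh : PAdicHeightData W p), q ≠ 0 → ‖q‖ < 1 → tateJ q = (W.j : ℚ_[p]) →
      IsMultCanonical Dh q → SchneiderConjecture Dh)
    (hSchS : ∀ (Dq : TateParameterData W p) (Dh : PAdicHeightData W p),
      IsSplitMultCanonical Dh Dq → SchneiderConjecture Dh)
    (hμ : ClassX9 W p → ∀ (κ : ZpExtension ℚ p) (γ : Field.absoluteGaloisGroup ℚ),
        κ.IsCyclotomic → κ.IsTopGenerator γ → IsCyclotomicVariable p γ →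
      ∀ (D : W.SelmerDualData κ γ), D.mu = 0)
    (hcert : ClassX9 W p → ∀ [NeZero (W.conductorNorm ℤ)]
        (f : CuspForm (CongruenceSubgroup.Gamma0 (W.conductorNorm ℤ)) 2),
        IsNewformOf W f → ∀ (ϖ : ℚ), (ϖ : ℝ) * W.realPeriodRat = plusPeriod f →
      ∃ n : ℕ, ‖PowerSeries.coeff n
        (PowerSeries.C (ϖ : ℚ_[p]) * padicLFunction f (unitRoot W p : ℚ_[p]))‖ = 1)
    (hA1 : ¬ (ClassX1 W p ∧ ¬ GVPar W p)) (hX11a : ¬ ClassX11a W p)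
    (hX2 : ¬ (ClassX2 W p ∧
      ¬ (W.analyticRank = 1 ∧ ¬ W.HasSplitMultiplicativeReductionAtPrime p ∧ GVPar W p)))
    (hX11b : ¬ (ClassX11b W p ∧ ¬ Ram W p)) : BSDp W p := by
  rcases hdom with hgo | hm
  · exact bsdp_goodOrd_of_five_le_of_schneider_of_greenbergMu hBCS hBCSa hGZK hCGS hGVg hGr hmod hmodP
      hS hPR hΩ hcm hr hgo h5 hSch hμ hcert hA1
  · refine bsdp_mult_of_schneider_sharp_cellC hSk hmod hGZK hA hJn hJs hHn hHs hD hmodP hGV hWu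
      (by omega) hm hr hSchN hSchS hX11a hX2 ?_
    rintro ⟨hX, hnot⟩
    by_cases hram : Ram W p
    · exact hnot ⟨hram, fun _ => h5⟩
    · exact hX11b ⟨hX, hram⟩

end Curve

end Summit.BirchSwinnertonDyer.Rank1Residual
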